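import Summits.CriticalPhenomena.CardyFormulaZ2.Theorems.CardyBoundaryCoulombGasRectilinearCardyQuarterTurns
import Summits.CriticalPhenomena.CardyFormulaZ2.Theorems.CardyBoundaryCoulombGasRectilinearCardyFrameArcs

/-!
# Stub `stub_boundaryArmTightness`, assembly II: from a standard-frame sector walk to a crossing
# of the discrete domain near the junction
# (line `excursion-kernel-covariance`, crux `RectilinearCardy`, stmt-CriticalPhenomena-5660)

The orientation-free heart of the junction estimates (`mem_discreteCrossing_of_sectorWalk`): an
open lattice walk of the standard frame inside the lattice sector, from beside the start ray to
beside the end ray through a deep hub, is turned back by `σ_c⁻ᵃ` into an open path of `Ω_δ`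
joining the discrete arcs of the two target boundary sets. Ingredients:
`meshPoint_quarterTurn_symm_iterate`, `inSec_of_latticeSector`, `inSec_convexComb_of_latticeSector`,
`exists_exit_or_forall_mem` (closedness of `Ω_δ` under mesh edges), `mem_discreteArc_of_frame`.
-/

noncomputable section

open Set Filter Topology MeasureTheory Metric
open Literature.Probability.RandomPlanarGeometry
open Literature.Probability.Percolation
open Literature.Probability.LatticeModels (Site zdGraph meshPoint meshDomain meshBoundary discreteArc
  meshVertices)





namespace Summit.CriticalPhenomena.CardyFormulaZ2.Cruxes.RectilinearCardy.ExcursionKernelCovariance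


/-- Iterates of a lattice automorphism preserve adjacency. [folklore] -/
theorem iterate_symm_adj_iff (φ : zdGraph 2 ≃g zdGraph 2) (k : ℕ) (x y : Site 2) :
    (zdGraph 2).Adj ((φ.symm)^[k] x) ((φ.symm)^[k] y) ↔ (zdGraph 2).Adj x y := by
  induction k generalizing x y with
  | zero => simp
  | succ k ih =>
    rw [Function.iterate_succ_apply', Function.iterate_succ_apply', SimpleGraph.Iso.map_adj_iff]
    exact ih x y

/-- **The frame coordinate of a rotated vertex.** For the inverse quarter turn `σ_c⁻¹` about `c`
iterated `a` times and the frame `u = (z - b)(-i)^a` at `b`: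
`u(δ σ_c⁻ᵃ z) = δ ((z₀ - c₀) + (z₁ - c₁) i) - (b - δ c)(-i)^a`. [folklore] -/
theorem frame_meshPoint_iterate (c : Site 2) (δ : ℝ) (b : ℂ) (a : ℕ) (z : Site 2) :
    (meshPoint δ ((((zdShiftIso c).comp ((zdSignedPermIso (Equiv.swap (0 : Fin 2) 1) ![1, -1]).comp
      (zdShiftIso (-c)))).symm)^[a] z) - b) * (-Complex.I) ^ a =
      (δ : ℂ) * ((((z 0 - c 0 : ℤ)) : ℂ) + (((z 1 - c 1 : ℤ)) : ℂ) * Complex.I) -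
        (b - meshPoint δ c) * (-Complex.I) ^ a := by
  rw [meshPoint_quarterTurn_symm_iterate]
  have h1 : Complex.I ^ a * (-Complex.I) ^ a = 1 := by rw [← mul_pow]; simp
  have h2 : meshPoint δ z - meshPoint δ c =
      (δ : ℂ) * ((((z 0 - c 0 : ℤ)) : ℂ) + (((z 1 - c 1 : ℤ)) : ℂ) * Complex.I) := by
    apply Complex.ext <;> simp <;> ring
  calc (meshPoint δ c + Complex.I ^ a * (meshPoint δ z - meshPoint δ c) - b) * (-Complex.I) ^ a
      = (meshPoint δ z - meshPoint δ c) * (Complex.I ^ a * (-Complex.I) ^ a) -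
          (b - meshPoint δ c) * (-Complex.I) ^ a := by ring
    _ = _ := by rw [h1, mul_one, h2]

/-- The frame coordinate in terms of the reduced offset `β = (b - δc)(-i)^a / δ`. [folklore] -/
theorem frame_eq_mul_sub_div {δ : ℝ} (hδ : 0 < δ) (P βδ : ℂ) :
    (δ : ℂ) * P - βδ = (δ : ℂ) * (P - βδ / (δ : ℂ)) := by
  rw [mul_sub, mul_div_cancel₀ _ (by exact_mod_cast hδ.ne' : (δ : ℂ) ≠ 0)]

/-- Real and imaginary parts of `p + q i - β`. [folklore] -/
theorem re_im_intCast_add_mul_I_sub (p q : ℤ) (β : ℂ) :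
    ((p : ℂ) + (q : ℂ) * Complex.I - β).re = (p : ℝ) - β.re ∧
      ((p : ℂ) + (q : ℂ) * Complex.I - β).im = (q : ℝ) - β.im := by constructor <;> simp

/-- Norm bound for the frame coordinate of a lattice point in the box `[-3l, 3l]²`. [folklore] -/
theorem norm_frame_le {δ : ℝ} (hδ : 0 < δ) {p q : ℤ} {l : ℕ} (hp : |p| ≤ 3 * l + 1)
    (hq : |q| ≤ 3 * l + 1) {βδ : ℂ} (hβ : ‖βδ‖ ≤ δ) :
    ‖(δ : ℂ) * ((p : ℂ) + (q : ℂ) * Complex.I) - βδ‖ ≤ (6 * l + 3) * δ := by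
  have h1 : ‖(δ : ℂ) * ((p : ℂ) + (q : ℂ) * Complex.I)‖ ≤ δ * (|(p : ℝ)| + |(q : ℝ)|) := by
    rw [norm_mul, Complex.norm_real, Real.norm_eq_abs, abs_of_pos hδ]
    refine mul_le_mul_of_nonneg_left ?_ hδ.le
    refine (Complex.norm_le_abs_re_add_abs_im _).trans ?_
    simp
  have hp' : |(p : ℝ)| ≤ 3 * l + 1 := by
    have : ((|p| : ℤ) : ℝ) ≤ ((3 * l + 1 : ℤ) : ℝ) := by exact_mod_cast hp
    push_cast at this; exact this
  have hq' : |(q : ℝ)| ≤ 3 * l + 1 := by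
    have : ((|q| : ℤ) : ℝ) ≤ ((3 * l + 1 : ℤ) : ℝ) := by exact_mod_cast hq
    push_cast at this; exact this
  calc ‖(δ : ℂ) * ((p : ℂ) + (q : ℂ) * Complex.I) - βδ‖
      ≤ ‖(δ : ℂ) * ((p : ℂ) + (q : ℂ) * Complex.I)‖ + ‖βδ‖ := norm_sub_le _ _
    _ ≤ δ * (|(p : ℝ)| + |(q : ℝ)|) + δ := add_le_add h1 hβ
    _ ≤ δ * ((3 * l + 1) + (3 * l + 1)) + δ := by gcongr
    _ = (6 * l + 3) * δ := by ring


/-- **Assembly (common part).** `D` a Jordan domain, `b ∈ ∂D`; within `r` of `b` the frontier is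
the start ray `A₁` and the end ray `A₂` of the frame `u = (z - b)(-i)^a` turned by `m` quadrants and
the domain is the standard sector of `m` quadrants; `P₁ ⊇ A₁`, `P₂ ⊇ A₂` beyond distance `λ` from
`b`, with complements near `b` inside the other ray or within `λ` of `b`; `c` a site with
`dist (δc) b ≤ δ`, `l ≥ 3`, `λ ≤ (l - 3)δ`, `20 l δ ≤ r`; the bulk of `D` at depth `κ ≤ (l - 2)δ`
near `b` lies in `Ω_δ`. Then an open lattice walk of the STANDARD frame (configuration
`σ_c^a ω`) inside the lattice sector and the box `c + [-3l, 3l]²`, from the first lattice row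
above the start ray (`z₁ - c₁ = ⌊β.im⌋ + 1`, `z₀ - c₀ ≥ l`, `β = (b - δc)(-i)^a / δ`) to a vertex
beside the end ray (frame-`(a+m)` coordinate with real part `≥ λ + 2δ`, imaginary part of modulus
`≤ δ`, a lattice neighbour outside the sector), through a hub at frame distance `≥ (l - 1)δ` from
both rays, gives `ω ∈ discreteCrossing D δ P₁ P₂`: turned back by `σ_c⁻ᵃ` it is an open path of
`Ω_δ` (sector points are domain points, unit steps stay in the sector, the hub is in the bulk,
`Ω_δ` is closed under mesh edges) with ends on the discrete arcs of `P₁`, `P₂`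
(`mem_discreteArc_of_frame`). [folklore] -/
theorem mem_discreteCrossing_of_sectorWalk (D : JordanDomain) {b : ℂ} {r : ℝ}
    {a m : ℕ} (hm : m = 1 ∨ m = 2 ∨ m = 3) {A₁ A₂ P₁ P₂ : Set ℂ}
    (hfront : ∀ z ∈ frontier D.carrier, dist z b < r → z ∈ A₁ ∨ z ∈ A₂)
    (hA₁ : ∀ z, dist z b < r → (z ∈ A₁ ↔ ((z - b) * (-Complex.I) ^ a).im = 0 ∧
      0 ≤ ((z - b) * (-Complex.I) ^ a).re))
    (hA₂ : ∀ z, dist z b < r → (z ∈ A₂ ↔ ((z - b) * (-Complex.I) ^ (a + m)).im = 0 ∧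
      0 ≤ ((z - b) * (-Complex.I) ^ (a + m)).re))
    (hΩ : ∀ z, dist z b < r → (z ∈ D.carrier ↔
      (m = 1 → 0 < ((z - b) * (-Complex.I) ^ a).re ∧ 0 < ((z - b) * (-Complex.I) ^ a).im) ∧
      (m = 2 → 0 < ((z - b) * (-Complex.I) ^ a).im) ∧
      (m = 3 → 0 < ((z - b) * (-Complex.I) ^ a).im ∨ ((z - b) * (-Complex.I) ^ a).re < 0)))
    {lam : ℝ} (hlam : 0 ≤ lam)
    (hP₁ne : (frontier D.carrier \ P₁).Nonempty) (hP₂ne : (frontier D.carrier \ P₂).Nonempty)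
    (hP₁a : ∀ z ∈ A₁, lam < dist z b → z ∈ P₁)
    (hP₁b : ∀ z ∈ frontier D.carrier, z ∉ P₁ → dist z b < r → z ∈ A₂ ∨ dist z b ≤ lam)
    (hP₂a : ∀ z ∈ A₂, lam < dist z b → z ∈ P₂)
    (hP₂b : ∀ z ∈ frontier D.carrier, z ∉ P₂ → dist z b < r → z ∈ A₁ ∨ dist z b ≤ lam)
    {δ : ℝ} (hδ : 0 < δ) {c : Site 2} (hcb : dist (meshPoint δ c) b ≤ δ) {l : ℕ} (hl : 3 ≤ l)
    (hlaml : lam ≤ ((l : ℝ) - 3) * δ) (hfit : 20 * (l : ℝ) * δ ≤ r)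
    {κ : ℝ} (hκl : κ ≤ ((l : ℝ) - 2) * δ)
    (hbulk : ∀ x : Site 2, meshPoint δ x ∈ D.carrier → dist (meshPoint δ x) b ≤ r / 2 →
      κ ≤ infDist (meshPoint δ x) (frontier D.carrier) → x ∈ meshDomain D.carrier δ)
    {ω : BondConfig (Site 2)} {vE vX : Site 2} (W₀ : (zdGraph 2).Walk vE vX)
    (hW₀e : ∀ e ∈ W₀.edges, e ∈ (BondConfig.relabel (sym2Equiv ((zdShiftIso c).comp
      ((zdSignedPermIso (Equiv.swap (0 : Fin 2) 1) ![1, -1]).comp (zdShiftIso (-c)))).toEquiv))^[a] ω)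
    (hW₀s : ∀ z ∈ W₀.support,
      ((m = 1 → ⌊(((b - meshPoint δ c) * (-Complex.I) ^ a) / (δ : ℂ)).re⌋ + 1 ≤ z 0 - c 0 ∧
          ⌊(((b - meshPoint δ c) * (-Complex.I) ^ a) / (δ : ℂ)).im⌋ + 1 ≤ z 1 - c 1) ∧
        (m = 2 → ⌊(((b - meshPoint δ c) * (-Complex.I) ^ a) / (δ : ℂ)).im⌋ + 1 ≤ z 1 - c 1) ∧
        (m = 3 → ⌊(((b - meshPoint δ c) * (-Complex.I) ^ a) / (δ : ℂ)).im⌋ + 1 ≤ z 1 - c 1 ∨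
          z 0 - c 0 ≤ ⌈(((b - meshPoint δ c) * (-Complex.I) ^ a) / (δ : ℂ)).re⌉ - 1)) ∧
      |z 0 - c 0| ≤ 3 * l ∧ |z 1 - c 1| ≤ 3 * l)
    (hvE : vE 1 - c 1 = ⌊(((b - meshPoint δ c) * (-Complex.I) ^ a) / (δ : ℂ)).im⌋ + 1 ∧
      (l : ℤ) ≤ vE 0 - c 0)
    (hvX : lam + 2 * δ ≤ (((δ : ℂ) * ((((vX 0 - c 0 : ℤ)) : ℂ) + (((vX 1 - c 1 : ℤ)) : ℂ) *
        Complex.I) - (b - meshPoint δ c) * (-Complex.I) ^ a) * (-Complex.I) ^ m).re ∧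
      |(((δ : ℂ) * ((((vX 0 - c 0 : ℤ)) : ℂ) + (((vX 1 - c 1 : ℤ)) : ℂ) * Complex.I) -
        (b - meshPoint δ c) * (-Complex.I) ^ a) * (-Complex.I) ^ m).im| ≤ δ)
    (hvXn : ∃ y : Site 2, (zdGraph 2).Adj vX y ∧ |y 0 - c 0| ≤ 3 * l + 1 ∧ |y 1 - c 1| ≤ 3 * l + 1 ∧
      ¬ ((m = 1 → 0 < ((δ : ℂ) * ((((y 0 - c 0 : ℤ)) : ℂ) + (((y 1 - c 1 : ℤ)) : ℂ) * Complex.I) -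
          (b - meshPoint δ c) * (-Complex.I) ^ a).re ∧
          0 < ((δ : ℂ) * ((((y 0 - c 0 : ℤ)) : ℂ) + (((y 1 - c 1 : ℤ)) : ℂ) * Complex.I) -
          (b - meshPoint δ c) * (-Complex.I) ^ a).im) ∧
        (m = 2 → 0 < ((δ : ℂ) * ((((y 0 - c 0 : ℤ)) : ℂ) + (((y 1 - c 1 : ℤ)) : ℂ) * Complex.I) -
          (b - meshPoint δ c) * (-Complex.I) ^ a).im) ∧
        (m = 3 → 0 < ((δ : ℂ) * ((((y 0 - c 0 : ℤ)) : ℂ) + (((y 1 - c 1 : ℤ)) : ℂ) * Complex.I) -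
          (b - meshPoint δ c) * (-Complex.I) ^ a).im ∨
          ((δ : ℂ) * ((((y 0 - c 0 : ℤ)) : ℂ) + (((y 1 - c 1 : ℤ)) : ℂ) * Complex.I) -
          (b - meshPoint δ c) * (-Complex.I) ^ a).re < 0)))
    {h : Site 2} (hh : h ∈ W₀.support)
    (hhub : ∀ ρ : ℝ, 0 ≤ ρ →
      ((l : ℝ) - 1) * δ ≤ ‖(δ : ℂ) * ((((h 0 - c 0 : ℤ)) : ℂ) + (((h 1 - c 1 : ℤ)) : ℂ) * Complex.I) -
          (b - meshPoint δ c) * (-Complex.I) ^ a - (ρ : ℂ)‖ ∧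
      ((l : ℝ) - 1) * δ ≤ ‖(δ : ℂ) * ((((h 0 - c 0 : ℤ)) : ℂ) + (((h 1 - c 1 : ℤ)) : ℂ) * Complex.I) -
          (b - meshPoint δ c) * (-Complex.I) ^ a - (ρ : ℂ) * Complex.I ^ m‖) :
    ω ∈ discreteCrossing D.carrier δ P₁ P₂ := by
  classical
  set σ := (zdShiftIso c).comp ((zdSignedPermIso (Equiv.swap (0 : Fin 2) 1) ![1, -1]).comp
    (zdShiftIso (-c))) with hσ
  set βδ : ℂ := (b - meshPoint δ c) * (-Complex.I) ^ a with hβδ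
  set β : ℂ := βδ / (δ : ℂ) with hβ
  set Ω := D.carrier with hΩdef
  have hl' : (3 : ℝ) ≤ l := by exact_mod_cast hl
  have hβδn : ‖βδ‖ ≤ δ := by
    rw [hβδ, norm_mul, norm_pow, norm_neg, Complex.norm_I, one_pow, mul_one, ← dist_eq_norm,
      dist_comm]; exact hcb
  have hβn : ‖β‖ ≤ 1 := by
    rw [hβ, norm_div, Complex.norm_real, Real.norm_eq_abs, abs_of_pos hδ, div_le_one hδ]
    exact hβδn
  have hβre : |β.re| ≤ 1 := (Complex.abs_re_le_norm β).trans hβn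
  set U : Site 2 → ℂ := fun z => (δ : ℂ) * ((((z 0 - c 0 : ℤ)) : ℂ) + (((z 1 - c 1 : ℤ)) : ℂ) *
    Complex.I) - βδ with hU
  have hUframe : ∀ z : Site 2, (meshPoint δ ((σ.symm)^[a] z) - b) * (-Complex.I) ^ a = U z :=
    fun z => frame_meshPoint_iterate c δ b a z
  have hUβ : ∀ z : Site 2, U z = (δ : ℂ) * ((((z 0 - c 0 : ℤ)) : ℂ) + (((z 1 - c 1 : ℤ)) : ℂ) *
      Complex.I - β) := fun z => frame_eq_mul_sub_div hδ _ _
  have hUdist : ∀ z : Site 2, dist (meshPoint δ ((σ.symm)^[a] z)) b = ‖U z‖ := fun z => by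
    rw [← hUframe z, norm_frame]
  have hUnorm : ∀ z : Site 2, |z 0 - c 0| ≤ 3 * l + 1 → |z 1 - c 1| ≤ 3 * l + 1 →
      ‖U z‖ ≤ (6 * l + 3) * δ := fun z h0 h1 => norm_frame_le hδ h0 h1 hβδn
  have h7r : (6 * (l : ℝ) + 3) * δ < r := by nlinarith
  have hinΩ : ∀ z : Site 2, |z 0 - c 0| ≤ 3 * l + 1 → |z 1 - c 1| ≤ 3 * l + 1 →
      ((m = 1 → 0 < (U z).re ∧ 0 < (U z).im) ∧ (m = 2 → 0 < (U z).im) ∧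
        (m = 3 → 0 < (U z).im ∨ (U z).re < 0)) → meshPoint δ ((σ.symm)^[a] z) ∈ Ω := by
    intro z h0 h1 hsec
    have hd : dist (meshPoint δ ((σ.symm)^[a] z)) b < r := by
      rw [hUdist]; exact (hUnorm z h0 h1).trans_lt h7r
    rw [hΩ _ hd, hUframe]
    exact hsec
  have hsecU : ∀ z ∈ W₀.support, (m = 1 → 0 < (U z).re ∧ 0 < (U z).im) ∧ (m = 2 → 0 < (U z).im) ∧
      (m = 3 → 0 < (U z).im ∨ (U z).re < 0) := by
    intro z hz
    rw [hUβ, inSec_real_mul_iff m hδ]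
    exact inSec_of_latticeSector m β _ _ (hW₀s z hz).1
  obtain ⟨W', hW'e, hW's⟩ := exists_walk_of_edges_mem_relabel_iterate σ a ω W₀ hW₀e
  have hsupp : ∀ x ∈ W'.support, ∃ z ∈ W₀.support, (σ.symm)^[a] z = x := fun x hx => (hW's x).1 hx
  have hW'Ω : ∀ x ∈ W'.support, meshPoint δ x ∈ Ω := by
    intro x hx
    obtain ⟨z, hz, rfl⟩ := hsupp x hx
    have hb := hW₀s z hz
    exact hinΩ z (by omega) (by omega) (hsecU z hz)
  -- unit steps of the walk stay in the domain
  have hW'seg : ∀ x y, s(x, y) ∈ W'.edges →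
      segment ℝ (meshPoint δ x) (meshPoint δ y) ⊆ Ω := by
    intro x y he ζ hζ
    have hx := W'.fst_mem_support_of_mem_edges he
    have hy := W'.snd_mem_support_of_mem_edges he
    have hadj := W'.adj_of_mem_edges he
    obtain ⟨z, hz, rfl⟩ := hsupp x hx
    obtain ⟨z', hz', rfl⟩ := hsupp y hy
    rw [iterate_symm_adj_iff] at hadj
    obtain ⟨t, ht0, ht1, hζt, hζd⟩ := frame_convexComb (b := b) (d := (-Complex.I) ^ a) hζ
    rw [hUframe, hUframe] at hζt
    have hd : dist ζ b < r := by
      refine hζd.trans_lt (max_lt ?_ ?_)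
      · rw [hUdist]; have := hW₀s z hz; exact (hUnorm z (by omega) (by omega)).trans_lt h7r
      · rw [hUdist]; have := hW₀s z' hz'; exact (hUnorm z' (by omega) (by omega)).trans_lt h7r
    rw [hΩ ζ hd, hζt, hUβ, hUβ, show (1 - (t : ℂ)) * ((δ : ℂ) * ((((z 0 - c 0 : ℤ)) : ℂ) +
        (((z 1 - c 1 : ℤ)) : ℂ) * Complex.I - β)) + (t : ℂ) * ((δ : ℂ) * ((((z' 0 - c 0 : ℤ)) : ℂ) +
        (((z' 1 - c 1 : ℤ)) : ℂ) * Complex.I - β)) = (δ : ℂ) * ((1 - (t : ℂ)) * ((((z 0 - c 0 : ℤ)) : ℂ) +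
        (((z 1 - c 1 : ℤ)) : ℂ) * Complex.I - β) + (t : ℂ) * ((((z' 0 - c 0 : ℤ)) : ℂ) +
        (((z' 1 - c 1 : ℤ)) : ℂ) * Complex.I - β)) by ring, inSec_real_mul_iff m hδ]
    have hadj' : (z' 0 - c 0 = z 0 - c 0 + 1 ∧ z' 1 - c 1 = z 1 - c 1) ∨
        (z 0 - c 0 = z' 0 - c 0 + 1 ∧ z' 1 - c 1 = z 1 - c 1) ∨
        (z' 1 - c 1 = z 1 - c 1 + 1 ∧ z' 0 - c 0 = z 0 - c 0) ∨
        (z 1 - c 1 = z' 1 - c 1 + 1 ∧ z' 0 - c 0 = z 0 - c 0) := by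
      rcases (zdGraph_two_adj_iff z z').1 hadj with h | h | h | h <;> omega
    exact inSec_convexComb_of_latticeSector m β _ _ _ _ hadj' (hW₀s z hz).1 (hW₀s z' hz').1 ht0 ht1
  -- the hub is in the bulk
  have hxhs : (σ.symm)^[a] h ∈ W'.support := (hW's _).2 ⟨h, hh, rfl⟩
  have hfne : (frontier Ω).Nonempty := let ⟨z, hz⟩ := hP₁ne; ⟨z, hz.1⟩
  -- rays in the frame
  have hA₁u : ∀ z ∈ A₁, dist z b < r → ∃ ρ : ℝ, 0 ≤ ρ ∧ (z - b) * (-Complex.I) ^ a = (ρ : ℂ) := by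
    intro z hz hd
    obtain ⟨him, hre⟩ := (hA₁ z hd).1 hz
    exact ⟨_, hre, Complex.ext (by simp) (by simp [him])⟩
  have hA₂u : ∀ z ∈ A₂, dist z b < r → ∃ ρ : ℝ, 0 ≤ ρ ∧
      (z - b) * (-Complex.I) ^ a = (ρ : ℂ) * Complex.I ^ m := by
    intro z hz hd
    obtain ⟨him, hre⟩ := (hA₂ z hd).1 hz
    refine ⟨_, hre, ?_⟩
    set w := (z - b) * (-Complex.I) ^ (a + m) with hw
    have h1 : w = ((w.re : ℝ) : ℂ) := Complex.ext (by simp) (by simp [him])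
    have h2 : (z - b) * (-Complex.I) ^ a = w * Complex.I ^ m := by
      rw [hw, pow_add, mul_assoc, mul_assoc, ← mul_pow]; simp
    rw [h2]
    exact congrArg (· * Complex.I ^ m) h1
  have hxhdom : (σ.symm)^[a] h ∈ meshDomain Ω δ := by
    have hb := hW₀s h hh
    refine hbulk _ (hW'Ω _ hxhs) ?_ ((le_infDist hfne).2 fun z hz => ?_)
    · rw [hUdist]; linarith [hUnorm h (by omega) (by omega)]
    · by_cases hzr : dist z b < r
      · have hdist : dist (meshPoint δ ((σ.symm)^[a] h)) z = ‖U h - (z - b) * (-Complex.I) ^ a‖ := by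
          rw [← norm_frame _ z a, ← hUframe h, ← sub_mul]; ring_nf
        rcases hfront z hz hzr with hz1 | hz2
        · obtain ⟨ρ, hρ, hρe⟩ := hA₁u z hz1 hzr
          rw [hdist, hρe]; exact hκl.trans (by linarith [(hhub ρ hρ).1])
        · obtain ⟨ρ, hρ, hρe⟩ := hA₂u z hz2 hzr
          rw [hdist, hρe]; exact hκl.trans (by linarith [(hhub ρ hρ).2])
      · push Not at hzr
        have h1 : dist z b ≤ dist (meshPoint δ ((σ.symm)^[a] h)) z +
            dist (meshPoint δ ((σ.symm)^[a] h)) b := by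
          have := dist_triangle z (meshPoint δ ((σ.symm)^[a] h)) b
          rwa [dist_comm z (meshPoint δ ((σ.symm)^[a] h))] at this
        have h2 : dist (meshPoint δ ((σ.symm)^[a] h)) b ≤ (6 * l + 3) * δ := by
          rw [hUdist]; exact hUnorm h (by omega) (by omega)
        linarith
  -- all vertices are in `Ω_δ`, joined to the hub
  have hreach : ∀ x ∈ W'.support, x ∈ meshDomain Ω δ ∧
      (openGraph ω ⊓ Literature.Probability.LatticeModels.discreteDomainGraph Ω δ).Reachable
        ((σ.symm)^[a] h) x := by
    have key : ∀ {v : Site 2} (Q : (zdGraph 2).Walk ((σ.symm)^[a] h) v),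
        (∀ e ∈ Q.edges, e ∈ W'.edges) → ∀ x ∈ Q.support, x ∈ meshDomain Ω δ ∧
          (openGraph ω ⊓ Literature.Probability.LatticeModels.discreteDomainGraph Ω δ).Reachable
            ((σ.symm)^[a] h) x := by
      intro v Q hQ
      rcases exists_exit_or_forall_mem (Ω := Ω) Q hxhdom (fun e he => hW'e e (hQ e he)) with
        ⟨x, y, -, -, he, -, -, -, hseg⟩ | ⟨hall, -⟩
      · exact absurd (hW'seg x y (hQ _ he)) hseg
      · exact hall
    intro x hx
    by_cases hxt : x ∈ (W'.takeUntil _ hxhs).support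
    · refine key (W'.takeUntil _ hxhs).reverse (fun e he => ?_) x (by simpa using hxt)
      rw [SimpleGraph.Walk.edges_reverse, List.mem_reverse] at he
      exact W'.edges_takeUntil_subset_edges hxhs he
    · have hx' : x ∈ (W'.dropUntil _ hxhs).support := by
        have := W'.take_spec hxhs
        rw [← this, SimpleGraph.Walk.mem_support_append_iff] at hx
        exact hx.resolve_left hxt
      exact key (W'.dropUntil _ hxhs) (fun e he => W'.edges_dropUntil_subset_edges hxhs he) x hx'
  -- the two ends
  have hxEs : (σ.symm)^[a] vE ∈ W'.support := (hW's _).2 ⟨vE, W₀.start_mem_support, rfl⟩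
  have hxXs : (σ.symm)^[a] vX ∈ W'.support := (hW's _).2 ⟨vX, W₀.end_mem_support, rfl⟩
  -- real parts behind `b`
  have hreI : ∀ ρ : ℝ, 0 ≤ ρ → ((ρ : ℂ) * Complex.I ^ m).re ≤ 0 ∧
      ((ρ : ℂ) * (-Complex.I) ^ m).re ≤ 0 := by
    intro ρ hρ
    rcases hm with rfl | rfl | rfl
    · simp
    · simp [pow_two]; exact hρ
    · simp [pow_succ]
  -- the start end lies on the discrete arc of `P₁`
  have hxE_arc : (σ.symm)^[a] vE ∈ discreteArc Ω δ P₁ := by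
    have hvE0 := hvE.1
    have hvEb := hW₀s vE W₀.start_mem_support
    obtain ⟨hUre, hUim⟩ := re_im_intCast_add_mul_I_sub (vE 0 - c 0) (vE 1 - c 1) β
    -- the neighbour below the start ray
    set y₀ : Site 2 := vE - Pi.single 1 1 with hy₀
    have hy₀0 : y₀ 0 = vE 0 := by simp [hy₀]
    have hy₀1 : y₀ 1 = vE 1 - 1 := by simp [hy₀]
    have hadj : (zdGraph 2).Adj vE y₀ :=
      (zdGraph_two_adj_iff vE y₀).2 (Or.inr (Or.inr (Or.inr ⟨by omega, by omega⟩)))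
    have hvEb0 := abs_le.1 hvEb.2.1
    have hvEb1 := abs_le.1 hvEb.2.2
    have hy₀b0 : |y₀ 0 - c 0| ≤ 3 * l + 1 := abs_le.2 ⟨by omega, by omega⟩
    have hy₀b1 : |y₀ 1 - c 1| ≤ 3 * l + 1 := abs_le.2 ⟨by omega, by omega⟩
    refine mem_discreteArc_of_frame (b := b) (r := r) (n := a) hδ hlam hP₁ne ?_ ?_ (hreach _ hxEs).1
      ((iterate_symm_adj_iff σ a vE y₀).2 hadj) ?_ ?_ ?_ ?_
    · intro z hzr hzim hzre
      have hz1 : z ∈ A₁ := (hA₁ z hzr).2 ⟨hzim, by linarith⟩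
      refine hP₁a z hz1 ?_
      rw [← norm_frame z b a]
      exact hzre.trans_le (Complex.re_le_norm _)
    · intro z hzf hzP hzr
      rcases hP₁b z hzf hzP hzr with hz2 | hzl
      · obtain ⟨ρ, hρ, hρe⟩ := hA₂u z hz2 hzr
        exact Or.inl (by rw [hρe]; exact (hreI ρ hρ).1)
      · exact Or.inr hzl
    · -- the neighbour is not a domain point
      intro hyΩ
      have hd : dist (meshPoint δ ((σ.symm)^[a] y₀)) b < r := by
        rw [hUdist]; exact (hUnorm y₀ hy₀b0 hy₀b1).trans_lt h7r
      rw [hΩ _ hd, hUframe, hUβ, inSec_real_mul_iff m hδ] at hyΩ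
      obtain ⟨hyre, hyim⟩ := re_im_intCast_add_mul_I_sub (y₀ 0 - c 0) (y₀ 1 - c 1) β
      have him0 : (((y₀ 0 - c 0 : ℤ) : ℂ) + ((y₀ 1 - c 1 : ℤ) : ℂ) * Complex.I - β).im ≤ 0 := by
        rw [hyim, hy₀1, show vE 1 - 1 - c 1 = ⌊β.im⌋ by omega]
        linarith [Int.floor_le β.im]
      have hre0 : 0 < (((y₀ 0 - c 0 : ℤ) : ℂ) + ((y₀ 1 - c 1 : ℤ) : ℂ) * Complex.I - β).re := by
        rw [hyre, hy₀0]
        have : ((l : ℤ) : ℝ) ≤ ((vE 0 - c 0 : ℤ) : ℝ) := by exact_mod_cast hvE.2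
        push_cast at this ⊢
        linarith [(abs_le.1 hβre).2]
      rcases hm with rfl | rfl | rfl
      · linarith [(hyΩ.1 rfl).2]
      · linarith [hyΩ.2.1 rfl]
      · rcases hyΩ.2.2 rfl with h | h <;> linarith
    · rw [hUframe, hUβ, Complex.mul_re, Complex.ofReal_re, Complex.ofReal_im, zero_mul, sub_zero,
        hUre]
      have : ((l : ℤ) : ℝ) ≤ ((vE 0 - c 0 : ℤ) : ℝ) := by exact_mod_cast hvE.2
      push_cast at this ⊢
      nlinarith [(abs_le.1 hβre).2]
    · rw [hUframe, hUβ, Complex.mul_im, Complex.ofReal_re, Complex.ofReal_im, zero_mul, add_zero,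
        hUim, hvE0]
      push_cast
      rw [abs_mul, abs_of_pos hδ]
      have h1 := Int.floor_le β.im
      have h2 := Int.lt_floor_add_one β.im
      have : |(⌊β.im⌋ : ℝ) + 1 - β.im| ≤ 1 := abs_le.2 ⟨by linarith, by linarith⟩
      nlinarith
    · rw [hUdist]; linarith [hUnorm vE (by omega) (by omega)]
  -- the end end lies on the discrete arc of `P₂`
  have hxX_arc : (σ.symm)^[a] vX ∈ discreteArc Ω δ P₂ := by
    obtain ⟨y, hyadj, hy0, hy1, hysec⟩ := hvXn
    have hframe' : ∀ z : ℂ, (z - b) * (-Complex.I) ^ (a + m) = (z - b) * (-Complex.I) ^ a *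
        (-Complex.I) ^ m := fun z => by rw [pow_add, mul_assoc]
    refine mem_discreteArc_of_frame (b := b) (r := r) (n := a + m) hδ hlam hP₂ne ?_ ?_ (hreach _ hxXs).1
      ((iterate_symm_adj_iff σ a vX y).2 hyadj) ?_ ?_ ?_ ?_
    · intro z hzr hzim hzre
      have hz2 : z ∈ A₂ := (hA₂ z hzr).2 ⟨hzim, by linarith⟩
      refine hP₂a z hz2 ?_
      rw [← norm_frame z b (a + m)]
      exact hzre.trans_le (Complex.re_le_norm _)
    · intro z hzf hzP hzr
      rcases hP₂b z hzf hzP hzr with hz1 | hzl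
      · obtain ⟨ρ, hρ, hρe⟩ := hA₁u z hz1 hzr
        refine Or.inl ?_
        rw [hframe', hρe]; exact (hreI ρ hρ).2
      · exact Or.inr hzl
    · intro hyΩ
      have hd : dist (meshPoint δ ((σ.symm)^[a] y)) b < r := by
        rw [hUdist]; exact (hUnorm y hy0 hy1).trans_lt h7r
      rw [hΩ _ hd, hUframe] at hyΩ
      exact hysec hyΩ
    · rw [hframe', hUframe]; exact hvX.1
    · rw [hframe', hUframe]; exact hvX.2
    · have := hW₀s vX W₀.end_mem_support
      rw [hUdist]; linarith [hUnorm vX (by omega) (by omega)]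
  exact ⟨_, hxE_arc, _, hxX_arc, (hreach _ hxEs).2.symm.trans (hreach _ hxXs).2⟩

end Summit.CriticalPhenomena.CardyFormulaZ2.Cruxes.RectilinearCardy.ExcursionKernelCovariance

end
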